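import Mathlib
import Summits.ValiantsHypothesis.ValiantsHypothesis.Theorems.FifoMatchingNNNotVPSpreadCofactorLowDegree
import Summits.ValiantsHypothesis.ValiantsHypothesis.Theorems.FifoMatchingNNLowDegreeCofactorHardCofactorBuysVertices
import Summits.ValiantsHypothesis.ValiantsHypothesis.Theorems.FifoMatchingNNDivisionHardTorusHomogeneous
import Literature.Computability.AlgebraicComplexity.NestFreeMatchingPoly
import HarnessLib

/-!
# Route FifoMatching — crux `NNNotVP` (stmt-ValiantsHypothesis-11615), line `division_split`:
# stub B2 `stub_spreadCofactorReduction` ⟺ its TORUS-HOMOGENEOUS hyper-degree tier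

Refines `spreadCofactorReduction_iff_hyperDegree` (B2 ⟺ cofactors of total degree `> 2^⌊n^{1/8}⌋`) and
`spreadCofactorReduction_iff_homogeneousHyperDegree`: the cofactor may moreover be assumed to be a
TORUS weight vector — all its monomials (multigraphs on `[2n]`) share ONE vertex-degree vector
(`NNLowDegreeCofactorHard.vertexDeg`) — because the top component for a generic vertex potential
`vertexWeight (2·deg h + 1)` is nonzero, torus-homogeneous (`TorusHomogeneous.vertexDeg_eq_of_mem_topComponent`),
and has a no costlier certificate (`TorusHomogeneous.complexity_topVertexComponent_le`: initial forms are
free over `ℝ≥0` and `NN_n` is homogeneous for every vertex potential), while B2's budget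
`2^((log₂ n + log₂ cost + k)^k)` is monotone in the cost; a top component of degree `≤ 2^⌊n^{1/8}⌋` is
served by the landed low tier `spreadCofactorReduction_of_totalDegree_le` (`h' := 1`).

* `spreadCofactorReduction_iff_torusTier` — B2 ⟺ «for some `k`, every nonzero TORUS-HOMOGENEOUS `h` of
  degree `> 2^⌊n^{1/8}⌋` has an `h'` with a monomial of support `≤ (log₂ n + k)^k` and
  `L₊(NN_n·h') ≤ 2^((log₂ n + log₂(L₊(NN_n·h) + L₊(h)) + k)^k)`».

Honest framing: a by-name LOCALISATION of what is open in stub B2 (its torus-homogeneous hyper-degree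
tier; cf. the companion `NNDivisionHard.TorusHomogeneous.nnDivisionHard_iff_torusTier` for crux 21181 and
`NNDivisionHard.ShadowCap.not_qp_shadow_bound_of_complexity` for why vertex counting of planar shadows of the
product does not reach it), not progress on it; `NNNotVP` and `VP ≠ VNP` remain OPEN (NOT proved).
No definitions, no named facts.
-/

noncomputable section

-- Sub = Summit single-conjunct layout: the duplicated namespace component is mandated by the tree.
set_option linter.dupNamespace false
set_option autoImplicit false

namespace Summit.ValiantsHypothesis.ValiantsHypothesis.Theorems.FifoMatching.NNNotVP.DivisionSplit

open MvPolynomial Literature.Computability.AlgebraicComplexity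
open Summit.ValiantsHypothesis.ValiantsHypothesis.Theorems.ZeroOneTransfer.Negative
open Summit.ValiantsHypothesis.ValiantsHypothesis.Theorems.FifoMatching.NNLowDegreeCofactorHard
  (vertexWeight vertexDeg)
open Summit.ValiantsHypothesis.ValiantsHypothesis.Theorems.FifoMatching.NNDivisionHard.TorusHomogeneous
  (vertexDeg_eq_of_mem_topComponent complexity_topVertexComponent_le)
open scoped NNReal

/-- **Stub B2 ⟺ its torus-homogeneous hyper-degree tier.**  What is OPEN in stub B2 of
stmt-ValiantsHypothesis-11615 is exactly: trading a nonzero cofactor `h` that is a torus weight vector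
(one vertex-degree vector for all monomials) of total degree `> 2^⌊n^{1/8}⌋` for a cofactor `h'`
with a monomial of polylog support at quasi-polynomial cost in `n` and the certificate cost. [folklore] -/
theorem spreadCofactorReduction_iff_torusTier :
    (∃ k : ℕ, ∀ (n : ℕ) (h : MvPolynomial (σ n) ℝ≥0), h ≠ 0 →
      ∃ h' : MvPolynomial (σ n) ℝ≥0, (∃ m ∈ h'.support, m.support.card ≤ (Nat.log 2 n + k) ^ k) ∧
        complexity (NN n * h') ≤
          2 ^ ((Nat.log 2 n + Nat.log 2 (complexity (NN n * h) + complexity h) + k) ^ k)) ↔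
    (∃ k : ℕ, ∀ (n : ℕ) (h : MvPolynomial (σ n) ℝ≥0), h ≠ 0 →
      (∀ d ∈ h.support, ∀ d' ∈ h.support, vertexDeg d = vertexDeg d') →
      2 ^ Nat.sqrt (Nat.sqrt (Nat.sqrt n)) < h.totalDegree →
      ∃ h' : MvPolynomial (σ n) ℝ≥0, (∃ m ∈ h'.support, m.support.card ≤ (Nat.log 2 n + k) ^ k) ∧
        complexity (NN n * h') ≤
          2 ^ ((Nat.log 2 n + Nat.log 2 (complexity (NN n * h) + complexity h) + k) ^ k)) := by
  constructor
  · rintro ⟨k, hk⟩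
    exact ⟨k, fun n h hh _ _ => hk n h hh⟩
  · rintro ⟨k₁, hk₁⟩
    obtain ⟨k₀, hk₀⟩ := spreadCofactorReduction_of_totalDegree_le
    -- monotonicity of the rate in `k`
    have rate : ∀ (a : ℕ) {k k' : ℕ}, k ≤ k' → (a + k) ^ k ≤ (a + k') ^ k' := by
      intro a k k' hk
      rcases Nat.eq_zero_or_pos k' with hk' | hk'
      · subst hk'
        have : k = 0 := by omega
        subst this
        exact le_rfl
      · calc (a + k) ^ k ≤ (a + k') ^ k := Nat.pow_le_pow_left (by omega) k
          _ ≤ (a + k') ^ k' := Nat.pow_le_pow_right (by omega) hk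
    -- transfer of a conclusion for a no costlier cofactor `g` to `h`, at a larger `k`
    have transfer : ∀ {k k' : ℕ}, k ≤ k' → ∀ (n : ℕ) (h g h' : MvPolynomial (σ n) ℝ≥0),
        complexity (NN n * g) + complexity g ≤ complexity (NN n * h) + complexity h →
        ((∃ m ∈ h'.support, m.support.card ≤ (Nat.log 2 n + k) ^ k) ∧
          complexity (NN n * h') ≤
            2 ^ ((Nat.log 2 n + Nat.log 2 (complexity (NN n * g) + complexity g) + k) ^ k)) →
        ((∃ m ∈ h'.support, m.support.card ≤ (Nat.log 2 n + k') ^ k') ∧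
          complexity (NN n * h') ≤
            2 ^ ((Nat.log 2 n + Nat.log 2 (complexity (NN n * h) + complexity h) + k') ^ k')) := by
      intro k k' hkk' n h g h' hcost ⟨⟨m, hm, hmc⟩, hc⟩
      refine ⟨⟨m, hm, hmc.trans (rate _ hkk')⟩, hc.trans (Nat.pow_le_pow_right (by norm_num) ?_)⟩
      have hlog : Nat.log 2 (complexity (NN n * g) + complexity g) ≤
          Nat.log 2 (complexity (NN n * h) + complexity h) := Nat.log_mono_right hcost
      calc (Nat.log 2 n + Nat.log 2 (complexity (NN n * g) + complexity g) + k) ^ k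
          ≤ (Nat.log 2 n + Nat.log 2 (complexity (NN n * h) + complexity h) + k) ^ k :=
            Nat.pow_le_pow_left (by omega) k
        _ ≤ (Nat.log 2 n + Nat.log 2 (complexity (NN n * h) + complexity h) + k') ^ k' := rate _ hkk'
    refine ⟨max k₀ k₁, fun n h hh => ?_⟩
    -- the free normalisation: the top vertex-potential component of `h`
    obtain ⟨hc1, hc2⟩ := complexity_topVertexComponent_le n (2 * h.totalDegree + 1) h
    set g := topComponent (vertexWeight (2 * h.totalDegree + 1)) h with hg
    have hne : g ≠ 0 := topComponent_ne_zero _ hh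
    have hcost : complexity (NN n * g) + complexity g ≤ complexity (NN n * h) + complexity h :=
      Nat.add_le_add hc1 hc2
    by_cases hd : g.totalDegree ≤ 2 ^ Nat.sqrt (Nat.sqrt (Nat.sqrt n))
    · obtain ⟨h', hh'⟩ := hk₀ n g hne hd
      exact ⟨h', transfer (le_max_left _ _) n h g h' hcost hh'⟩
    · obtain ⟨h', hh'⟩ := hk₁ n g hne (fun d hd' d' hd'' => vertexDeg_eq_of_mem_topComponent h hd' hd'')
        (lt_of_not_ge hd)
      exact ⟨h', transfer (le_max_right _ _) n h g h' hcost hh'⟩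

end Summit.ValiantsHypothesis.ValiantsHypothesis.Theorems.FifoMatching.NNNotVP.DivisionSplit

end
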